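import Summits.BirchSwinnertonDyer.BirchSwinnertonDyer.Theorems.ByReductionTypeAtTwoOrdKatoHalfAtTwoIsoConjATwoCubicModelOfClassicalMu
import Summits.BirchSwinnertonDyer.BirchSwinnertonDyer.Theorems.ByReductionTypeAtTwoFineSelmerConjAAtTwoAdditivePotGoodTwoLayerDoorEvenIndex
import Summits.BirchSwinnertonDyer.BirchSwinnertonDyer.Theorems.ByReductionTypeAtTwoFineSelmerConjAAtTwoAdditivePotGoodEisensteinDoor
import Summits.BirchSwinnertonDyer.BirchSwinnertonDyer.Theorems.ByReductionTypeAtTwoFineSelmerConjAAtTwoAdditivePotGoodInertDoor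
import Summits.BirchSwinnertonDyer.BirchSwinnertonDyer.Theorems.ByReductionTypeAtTwoFineSelmerConjAAtTwoAdditivePotGoodCurveFreeHeart
import HarnessLib

/-!
# KERNEL (A)₂ rows for `y² = x³ + px² + qx + r` with NEGATIVE cubic discriminant — the cell's `hLim2` cubic-model doors with the Lim 2017
# named fact REMOVED (crux `OrdKatoHalfAtTwoIso`, stmt-BirchSwinnertonDyer-19573; K4 cone; cell bsd-2adic)

Written by the prover seat `cruxlead-stmt-BirchSwinnertonDyer-19573-w2` GEN 7 (`--supports` stmt-BirchSwinnertonDyer-19573; no item closed; BSD is NOT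
proved here). Module (E-g): each `classicalMuVanishes_two_adjoin_of_*` certificate of the cell (k4-w1 / addL2x doors, namespace `AddKatoTwo`) composed with
`TotallyComplexMu.conjA_two_cubicModel_of_classicalMu_of_discr_neg` (E-f). On the locus `disc(X³ + pX² + qX + r) < 0` this turns the CONDITIONAL rows

* `AddKatoTwo.fineSelmerDual_moduleFinite_two_cubicModel_of_odd hLim2 …` (INERT door: `r` odd, `p + q` odd, `h(ℚ(β))` odd),
* `AddKatoTwo.fineSelmerDual_moduleFinite_two_cubicModel_of_eisenstein hLim2 …` (EISENSTEIN door),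
* `AddKatoTwo.fineSelmerDual_moduleFinite_two_cubicModel_of_odd_discr hLim2 …` (TWO-LAYER door: odd cubic discriminant + layer-1 certificate),
* `AddKatoTwo.fineSelmerDual_moduleFinite_two_of_evenIndexCertificate_pointField hLim2 …` (EVEN-INDEX door),

into KERNEL theorems (same hypotheses minus `hLim2`, plus `disc < 0`): `conjA_two_cubicModel_of_odd_of_discr_neg`,
`conjA_two_cubicModel_of_eisenstein_of_discr_neg`, `conjA_two_cubicModel_of_odd_discr_of_discr_neg`,
`conjA_two_cubicModel_of_evenIndexCertificate_of_discr_neg`. The first two are also reachable by the GENUS DOOR (`conjA_two_cubicModel_of_genus`: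
one prime above `2`); the last two are NOT (there `2` is unramified, resp. of even index, in `ℚ(β)`).

References: [Iwasawa1973MuInvariants] Thm. 2/3; [CoatesSujatha2005] §3; [Washington1997] §13; [Fukuda1994] Thm. 1.
-/

set_option autoImplicit false

noncomputable section

open scoped NumberField Polynomial
open NumberField Field Polynomial

namespace Summit.BirchSwinnertonDyer.BirchSwinnertonDyer.Theorems.SteinbergFibreAtTwo.TotallyComplexMu

open Literature.NumberTheory.EllipticCurves Literature.NumberTheory.EllipticCurves.ZpExtension
  Literature.NumberTheory.GaloisRepresentations Literature.NumberTheory.IwasawaTheory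
  Summit.BirchSwinnertonDyer.BirchSwinnertonDyer.Theorems.AddKatoTwo

/-- **KERNEL INERT row** (`hLim2` removed from `AddKatoTwo.fineSelmerDual_moduleFinite_two_cubicModel_of_odd` on `disc < 0`): `r` odd, `p + q` odd
(so `2` is inert in the cubic field `ℚ(β)`), `h(ℚ(β))` odd, `disc(X³ + pX² + qX + r) < 0` ⟹ statement (A) at `2` for `y² = x³ + px² + qx + r`
(`∃ γ D` kernel form, every cyclotomic `κ`). [cite: Iwasawa1973MuInvariants, Thm. 2 and Thm. 3] [cite: CoatesSujatha2005, §3 Thm. 3.4 and Cor. 3.6] -/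
theorem conjA_two_cubicModel_of_odd_of_discr_neg (p q r : ℤ) [((⟨0, (p : ℚ), 0, (q : ℚ), (r : ℚ)⟩ : WeierstrassCurve ℚ)).IsElliptic]
    (hr : Odd r) (hpq : Odd (p + q)) (hd : Cubic.discr ⟨1, (p : ℚ), q, r⟩ < 0)
    {β : AlgebraicClosure ℚ} (hβ : aeval β (Cubic.toPoly ⟨1, (p : ℚ), q, r⟩) = 0)
    (hh : ¬ 2 ∣ Nat.card (ClassGroup (𝓞 ↥(IntermediateField.adjoin ℚ ({β} : Set (AlgebraicClosure ℚ))))))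
    (κ : ZpExtension ℚ 2) (hκ : κ.IsCyclotomic) :
    ∃ (γ : absoluteGaloisGroup ℚ) (D : ((⟨0, (p : ℚ), 0, (q : ℚ), (r : ℚ)⟩ : WeierstrassCurve ℚ)).FineSelmerDualData κ γ),
      Module.Finite ℤ_[2] (RestrictScalars ℤ_[2] (IwasawaAlgebra 2) D.X) :=
  conjA_two_cubicModel_of_classicalMu_of_discr_neg p q r (irreducible_cubic_of_odd hr hpq) hd hβ
    (fun κP _ ↦ classicalMuVanishes_two_adjoin_of_odd hr hpq hβ hh κP) κ hκ

/-- **KERNEL EISENSTEIN row** (`hLim2` removed from `AddKatoTwo.fineSelmerDual_moduleFinite_two_cubicModel_of_eisenstein` on `disc < 0`): `p, q, r`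
even, `4 ∤ r` (Eisenstein at `2`: `2` totally ramified in `ℚ(β)`), `h(ℚ(β))` odd, `disc < 0` ⟹ statement (A) at `2` for `y² = x³ + px² + qx + r`.
[cite: Iwasawa1973MuInvariants, Thm. 2 and Thm. 3] [cite: CoatesSujatha2005, §3 Thm. 3.4 and Cor. 3.6] -/
theorem conjA_two_cubicModel_of_eisenstein_of_discr_neg (p q r : ℤ) [((⟨0, (p : ℚ), 0, (q : ℚ), (r : ℚ)⟩ : WeierstrassCurve ℚ)).IsElliptic]
    (hp : Even p) (hq : Even q) (hr : Even r) (hr4 : ¬ (4 : ℤ) ∣ r) (hd : Cubic.discr ⟨1, (p : ℚ), q, r⟩ < 0)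
    {β : AlgebraicClosure ℚ} (hβ : aeval β (Cubic.toPoly ⟨1, (p : ℚ), q, r⟩) = 0)
    (hh : ¬ 2 ∣ Nat.card (ClassGroup (𝓞 ↥(IntermediateField.adjoin ℚ ({β} : Set (AlgebraicClosure ℚ))))))
    (κ : ZpExtension ℚ 2) (hκ : κ.IsCyclotomic) :
    ∃ (γ : absoluteGaloisGroup ℚ) (D : ((⟨0, (p : ℚ), 0, (q : ℚ), (r : ℚ)⟩ : WeierstrassCurve ℚ)).FineSelmerDualData κ γ),
      Module.Finite ℤ_[2] (RestrictScalars ℤ_[2] (IwasawaAlgebra 2) D.X) :=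
  conjA_two_cubicModel_of_classicalMu_of_discr_neg p q r (irreducible_cubic_of_eisenstein hp hq hr hr4) hd hβ
    (fun κP _ ↦ classicalMuVanishes_two_adjoin_of_eisenstein hp hq hr hr4 hβ hh κP) κ hκ

/-- **KERNEL TWO-LAYER row** (`hLim2` removed from `AddKatoTwo.fineSelmerDual_moduleFinite_two_cubicModel_of_odd_discr` on `disc < 0`; NOT a genus-door
row — `2` is unramified in `ℚ(β)`): cubic irreducible with ODD and NEGATIVE discriminant, `h(ℚ(β))` odd, and the layer-1 certificate
`e₁(ℚ(β)·ℚ_1) = 0` for the cyclotomic `ℤ₂`-extensions of `ℚ(β)` ⟹ statement (A) at `2` for `y² = x³ + px² + qx + r`.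
[cite: Iwasawa1973MuInvariants, Thm. 2 and Thm. 3] [cite: Fukuda1994, Thm. 1] [cite: CoatesSujatha2005, §3 Thm. 3.4 and Cor. 3.6] -/
theorem conjA_two_cubicModel_of_odd_discr_of_discr_neg (p q r : ℤ) [((⟨0, (p : ℚ), 0, (q : ℚ), (r : ℚ)⟩ : WeierstrassCurve ℚ)).IsElliptic]
    (hirr : Irreducible (Cubic.toPoly ⟨1, (p : ℚ), q, r⟩)) (hdisc : ¬ (2 : ℤ) ∣ Cubic.discr ⟨1, p, q, r⟩)
    (hd : Cubic.discr ⟨1, (p : ℚ), q, r⟩ < 0)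
    {β : AlgebraicClosure ℚ} (hβ : aeval β (Cubic.toPoly ⟨1, (p : ℚ), q, r⟩) = 0)
    (hh : ¬ 2 ∣ Nat.card (ClassGroup (𝓞 ↥(IntermediateField.adjoin ℚ ({β} : Set (AlgebraicClosure ℚ))))))
    (h1 : haveI : FiniteDimensional ℚ ↥(IntermediateField.adjoin ℚ ({β} : Set (AlgebraicClosure ℚ))) :=
        IntermediateField.adjoin.finiteDimensional ((AlgebraicClosure.isAlgebraic ℚ).isAlgebraic β).isIntegral
      haveI : NumberField ↥(IntermediateField.adjoin ℚ ({β} : Set (AlgebraicClosure ℚ))) := NumberField.mk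
      ∀ κL : ZpExtension ↥(IntermediateField.adjoin ℚ ({β} : Set (AlgebraicClosure ℚ))) 2, κL.IsCyclotomic → classNumberPExp κL 1 = 0)
    (κ : ZpExtension ℚ 2) (hκ : κ.IsCyclotomic) :
    ∃ (γ : absoluteGaloisGroup ℚ) (D : ((⟨0, (p : ℚ), 0, (q : ℚ), (r : ℚ)⟩ : WeierstrassCurve ℚ)).FineSelmerDualData κ γ),
      Module.Finite ℤ_[2] (RestrictScalars ℤ_[2] (IwasawaAlgebra 2) D.X) :=
  conjA_two_cubicModel_of_classicalMu_of_discr_neg p q r hirr hd hβ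
    (fun κP hκP ↦ classicalMuVanishes_two_adjoin_of_odd_cubic_discr hirr hdisc hβ hh κP hκP (h1 κP hκP)) κ hκ

/-- **KERNEL EVEN-INDEX row** (`hLim2` removed from `AddKatoTwo.fineSelmerDual_moduleFinite_two_of_evenIndexCertificate_pointField` on the cubic
model with `disc < 0`; NOT a genus-door row): cubic irreducible with NEGATIVE discriminant, `θ` a root, an even-index certificate `(u, v, m, m')` in
`𝓞_{ℚ(θ)}` (`u² − 2v² = 4m`, `m² = 2m'`, `8 ∤ N(2 − m'³)`), `h(ℚ(θ))` odd and the layer-1 certificate ⟹ statement (A) at `2` for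
`y² = x³ + px² + qx + r`. [cite: Iwasawa1973MuInvariants, Thm. 2 and Thm. 3] [cite: Fukuda1994, Thm. 1] [cite: CoatesSujatha2005, §3 Thm. 3.4 and Cor. 3.6] -/
theorem conjA_two_cubicModel_of_evenIndexCertificate_of_discr_neg (p q r : ℤ)
    [((⟨0, (p : ℚ), 0, (q : ℚ), (r : ℚ)⟩ : WeierstrassCurve ℚ)).IsElliptic]
    (hirr : Irreducible (Cubic.toPoly ⟨1, (p : ℚ), q, r⟩)) (hd : Cubic.discr ⟨1, (p : ℚ), q, r⟩ < 0)
    {θ : AlgebraicClosure ℚ} (hθ : aeval θ (Cubic.toPoly ⟨1, (p : ℚ), q, r⟩) = 0)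
    (u v m m' : 𝓞 ↥(IntermediateField.adjoin ℚ ({θ} : Set (AlgebraicClosure ℚ)))) (huv : u ^ 2 - 2 * v ^ 2 = 4 * m) (hm : m ^ 2 = 2 * m')
    (hN : ¬ (8 : ℤ) ∣ Algebra.norm ℤ (2 - m' ^ 3))
    (hh : ¬ 2 ∣ Nat.card (ClassGroup (𝓞 ↥(IntermediateField.adjoin ℚ ({θ} : Set (AlgebraicClosure ℚ))))))
    (h1 : haveI : FiniteDimensional ℚ ↥(IntermediateField.adjoin ℚ ({θ} : Set (AlgebraicClosure ℚ))) :=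
        IntermediateField.adjoin.finiteDimensional ((AlgebraicClosure.isAlgebraic ℚ).isAlgebraic θ).isIntegral
      haveI : NumberField ↥(IntermediateField.adjoin ℚ ({θ} : Set (AlgebraicClosure ℚ))) := NumberField.mk
      ∀ κL : ZpExtension ↥(IntermediateField.adjoin ℚ ({θ} : Set (AlgebraicClosure ℚ))) 2, κL.IsCyclotomic → classNumberPExp κL 1 = 0)
    (κ : ZpExtension ℚ 2) (hκ : κ.IsCyclotomic) :
    ∃ (γ : absoluteGaloisGroup ℚ) (D : ((⟨0, (p : ℚ), 0, (q : ℚ), (r : ℚ)⟩ : WeierstrassCurve ℚ)).FineSelmerDualData κ γ),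
      Module.Finite ℤ_[2] (RestrictScalars ℤ_[2] (IwasawaAlgebra 2) D.X) :=
  conjA_two_cubicModel_of_classicalMu_of_discr_neg p q r hirr hd hθ
    (fun κP hκP ↦ classicalMuVanishes_two_adjoin_of_evenIndexCertificate hirr hθ u v m m' huv hm hN hh κP hκP (h1 κP hκP)) κ hκ

end Summit.BirchSwinnertonDyer.BirchSwinnertonDyer.Theorems.SteinbergFibreAtTwo.TotallyComplexMu

end
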